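import Summits.HodgeConjecture.HodgeConjecture.Theorems.F3DualAbelianSchemeMStubMa   -- (Ma) closer `…CorCM.HypDel.F3DualAbelianSchemeM.stub_F3Ma_holds` (B-p19 (g18) rf 4e472003; files after B3 + brick #4 ★)
import Summits.HodgeConjecture.HodgeConjecture.Theorems.F3DualAbelianSchemeMStubMb   -- ★ p792832 (Mb) closer `…F3DualAbelianSchemeM.stub_F3Mb_holds` (B-p16 (g18))
import Summits.HodgeConjecture.HodgeConjecture.Theorems.F3DualAbelianSchemeMStubMc   -- T2 (Mc) closer `…F3DualAbelianSchemeM.stub_F3Mc_holds` (B-p02 (g17) ∕ F0P1c-p05; files after T1 ★)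
import Literature.AlgebraicGeometry.AbelianSchemes.DualPairHatActionOfBaseChangeSquares       -- ★ p791960 (Md1) closer (B-p13 (g21) E6)
import Literature.AlgebraicGeometry.AbelianSchemes.AbelianSchemeBaseQuotientDescentOfAffineBase -- ★ p788903 (Md2) closer (B-p13 (g21) E4)
import Literature.AlgebraicGeometry.AbelianSchemes.DualPairBaseQuotientDescentOfNoetherian     -- ★ p793105 (Md3) closer (B-p13 (g21) E3)
import Literature.AlgebraicGeometry.AbelianSchemes.DualPairBaseQuotientDescent
import Literature.AlgebraicGeometry.AbelianSchemes.AbelianSchemeKOfL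
import Literature.AlgebraicGeometry.AbelianSchemes.AbelianSchemeDualPairNormalize
import Literature.AlgebraicGeometry.Morphisms.ProjectiveMorphismComposition
import HarnessLib

/-!
# F-3 sub-line `Cruxes/HDel/Lines/F3DualAbelianScheme` — stub (M) `stub_F3M` CLOSED IN TREE: Mumford's dual abelian scheme
# `(A ⁄ K(L), 𝒫)` over a connected Noetherian affine `ℚ`-base (the (M) child line, Theorems-homed)

Summit `HodgeConjecture`, sub-problem `HodgeConjecture` (crux item `stmt-HodgeConjecture-24835`, HDel), namespace
`Summit.HodgeConjecture.CorCM.Cruxes.HypDel.F3DualAbelianScheme` (the registered F-3 sub-line's).  `stub_F3M_holds` is the letter of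
`stub_F3M` (`Cruxes/HDel/Lines/F3DualAbelianScheme.lean` ed. 1.4 :166–176) TOKEN FOR TOKEN.  This file is rung T3 of the in-tree
closing ladder (F0P1c-plan (g0) PLAN v1.3 §3(b), 2026-08-30): a `Cruxes/…/Lines` workfile is not importable, so the PROVED glue of
the (M) child line `Cruxes/HDel/Lines/F3DualAbelianSchemeM.lean` (ed. 5, §8 `stub_F3M_of`) is RE-HOMED here with every second-layer
letter consumed BY NAME over tree theorems: (Ma) `Summit.HodgeConjecture.CorCM.HypDel.F3DualAbelianSchemeM.stub_F3Ma_holds`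
(`Theorems/F3DualAbelianSchemeMStubMa`), (Mb) `…Cruxes.HypDel.F3DualAbelianSchemeM.stub_F3Mb_holds` (★ p792832
`Theorems/F3DualAbelianSchemeMStubMb`), (Mc) `…Cruxes.HypDel.F3DualAbelianSchemeM.stub_F3Mc_holds` (`Theorems/F3DualAbelianSchemeMStubMc`,
rung T2; B-p02 (g17) 23:03:39Z names), and (Md1)(Md2)(Md3) over ★ `DualPair.exists_actionOver_hat_of_isBaseChangeVia` ∕ ★ `exists_abelianScheme_desc_of_forall_finset`
∕ ★ `exists_dualPair_fields_of_free_base_quotient'` through the three thin letters of `namespace MClosure` (statements = the child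
line's (Md1)(Md2)(Md3) verbatim, bodies = ed. 5's).  ((Ma0) is consumed inside the (Ma) closer and does not appear.)  The parent
line then discharges `stub_F3M` by `exact stub_F3M_holds` (ed. 1.6).  0 new mathematics.  Cell `hodgecm-mathlib` (D-0151); glue
typed by B-typ04 (g15) ∕ B-typ02 (g17) on B-plan1 (g19)'s cut, letters closed by B-p19 (g18) (Ma), B-p16 (g18) (Mb), the (Mc) N-line
seats, B-p13 (g21) (Md); re-homed by B-p10 (g14).  HC_CM is proved only modulo the 7 printed citations until rung 0 closes; this
file discharges none of them (it closes one registered stub of the F-3 sub-line of the P1 line under HDel).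
-/

noncomputable section

open CategoryTheory CategoryTheory.Limits AlgebraicGeometry MonoidalCategory CartesianMonoidalCategory
open scoped MonObj
open Literature.AlgebraicGeometry.AbelianSchemes Literature.AlgebraicGeometry.RelativeSpec
  Literature.AlgebraicGeometry.Motives Literature.AlgebraicGeometry.AbelianVarieties Literature.AlgebraicGeometry.Modules
open Literature.AlgebraicGeometry.Morphisms (IsProjective)

namespace Summit.HodgeConjecture.CorCM.Cruxes.HypDel.F3DualAbelianScheme

/-! ## §1 The three (Md) letters of the (M) child line, Theorems-homed (statements verbatim; bodies = child ed. 5 by name over ★) -/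

namespace MClosure

/-! ### (Md1) — the `G`-action on the dual covering `ρ`, from dual-pair uniqueness -/

/-- **letter (Md1) `stub_F3Md1`** — [MilneAV2008, I §8 (the dual pair is unique up to a unique isomorphism)] in the free-base-quotient
carrier: `p : S → Q = S/G` free (carrier of record), `A/S` the base change of `B/Q` along `p` with the covering action `ρA` by
isomorphisms of group schemes (`hAB`, `hA`), and `D = (Â, 𝒫)` a HAT-NORMALISED dual pair of `A` (`𝒫|_{A × {ε_Â}} ≅ 𝒪`, ★
`DualPair.normalize`).  Then `G` acts on `Â` over `Â → S → Q`, covering `ρ` (`ρ̂(g)` over `ρ(g)`) by isomorphisms of group schemes,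
with the POINCARÉ INVARIANCE clause `(ρA(g) × ρ̂(g))^*𝒫 ≅ 𝒫` for all `g` — exactly the inputs `ρh`/`hAh`/`hP` of (Md3).  Road: `ρ̂(g) :=`
★ `DualPair.hatTransportOfBaseChange D D (hA g)` (FILE A `AbelianSchemeDualTransportOfBaseChange`: the transport along a base-change
square, its Poincaré clause `nonempty_pullback_map_hatTransportOfBaseChange_iso`, uniqueness ⇒ multiplicativity, group-scheme clause ★
`hat_isBaseChangeVia_hatTransportOfBaseChange_of_isLocallyNoetherian` under the unit hypothesis, or ★ `…OfBaseChangeAnyBase`).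
[cite: MilneAV2008, I §8 pp. 36–37] [cite: MumfordFogartyKirwan1994, Ch. 6 §1 Cor. 6.4 (p. 117) and Ch. 7 §3 remark after Thm. 7.9 (p. 139)] -/
theorem stub_F3Md1 : ∀ {S Q : Scheme.{0}} {p : S ⟶ Q} {G : Type} [Group G] [Fintype G] (ρ : ActionOver p G)
    (_hq : ρ.IsGeometricQuotient p) [IsAffineHom p]
    (_hfree : ∀ (V : Q.Opens), IsAffineOpen V → ∀ g : G, g ≠ 1 →
      Ideal.span (Set.range fun s : Γ(S, p ⁻¹ᵁ V) ↦ ρ.act g V s - s) = ⊤)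
    (A : AbelianSchemeOver S) (D : A.DualPair)
    (B : AbelianSchemeOver Q) {π : A.X.left ⟶ B.X.left} (ρA : ActionOver π G) (_hAB : A.IsBaseChangeVia B p π)
    (hA : ∀ g : G, A.IsBaseChangeVia A (ρ.aut g).hom (ρA.aut g).hom) [IsLocallyNoetherian S]
    (_unit : Nonempty ((Scheme.Modules.pullback (AbelianSchemeOver.DualPair.unitHatSlice D)).obj D.P ≅ SheafOfModules.unit _)),
    ∃ (ρh : ActionOver (D.hat.X.hom ≫ p) G) (_ : ∀ g : G, (ρh.aut g).hom ≫ D.hat.X.hom = D.hat.X.hom ≫ (ρ.aut g).hom)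
      (hAh : ∀ g : G, D.hat.IsBaseChangeVia D.hat (ρ.aut g).hom (ρh.aut g).hom),
      ∀ g : G, Nonempty ((Scheme.Modules.pullback
        (pullback.map A.X.hom D.hat.X.hom A.X.hom D.hat.X.hom (ρA.aut g).hom (ρh.aut g).hom (ρ.aut g).hom
          (hA g).fst.symm (hAh g).fst.symm)).obj D.P ≅ D.P) := by
  intro S Q p G _ _ ρ _ _ _ A D B π ρA _ hA _ hunit
  obtain ⟨ρh, -, hover, hAh, hP⟩ := AbelianSchemeOver.DualPair.exists_actionOver_hat_of_isBaseChangeVia ρ D ρA hA hunit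
  exact ⟨ρh, hover, hAh, hP⟩

/-! ### (Md2) — OBJECT DESCENT of the dual along the free base quotient (price-sheet LACK (Q2c), Galois form) -/

/-- **letter (Md2) `stub_F3Md2`** — [SGA1, Exp. VIII Cor. 7.8 (effective descent of quasi-projective schemes)] in its cheapest,
free-finite-quotient form ([MumfordAV1970, §7 Thm. p. 66; §12 Thm. 1 (p. 112)]): `p : S → Q = S/G` a free finite base quotient (carrier
of record; `p` affine, locally of finite type; `S`, `Q` locally Noetherian, `Q` AFFINE — binder `[IsAffine Q]` added 19:19Z on B-p13 (g21)'s
closing over (E4) `exists_abelianScheme_desc_of_forall_finset`; the composition instantiates `Q := Spec R`), `X → S` an abelian scheme in which EVERY FINITE SET OF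
POINTS LIES IN AN AFFINE OPEN (quasi-projective over an affine base suffices — (Mb)'s last conjunct), with a `G`-action `ρX` over
`X → S → Q` covering `ρ` by isomorphisms of group schemes.  Then the quotient `X/G` is an ABELIAN SCHEME `B̂ → Q` with separated total
space, the quotient map `π̂ : X → B̂` is `G`-invariant and exhibits `X` as the base change of `B̂` along `p` as a group scheme.  Road:
`G`-stable affine cover (★ `forall_exists_mem_stableAffineOpens_of_orbit` pattern) ⇒ ★ `ActionOver.glued` / `isGeometricQuotient_gluedMk`
/ `isSeparated_gluedDesc` / `isProper_gluedDesc`; the group law, smoothness and geometric connectedness of `X/G → Q` descend because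
`X → X/G` is a base change of the finite étale `S → Q` (★ `GeometricQuotientFreeBaseChange`, `GeometricQuotientGroupLaw`; cartesian
square by ★ `isPullback_of_equivariant_of_free`).  New tree work (L−): the assembly «free quotient of an abelian scheme COVERING a free
base quotient is an abelian scheme over the quotient base» — the E-road ★ `AbelianSchemeBaseQuotientDescent` descends `A` when `B` is
GIVEN; here `B̂` is PRODUCED. [cite: SGA1, Exp. VIII Cor. 7.8] [cite: MumfordAV1970, §7 Thm. p. 66 and §12 Thm. 1 (p. 112)]
[cite: MumfordFogartyKirwan1994, Ch. 7 §3 remark after Thm. 7.9 (p. 139)] -/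
theorem stub_F3Md2 : ∀ {S Q : Scheme.{0}} [IsAffine Q] {p : S ⟶ Q} {G : Type} [Group G] [Fintype G] (ρ : ActionOver p G)
    (_hq : ρ.IsGeometricQuotient p) [IsAffineHom p] [LocallyOfFiniteType p] [IsLocallyNoetherian S] [IsLocallyNoetherian Q]
    (_hfree : ∀ (V : Q.Opens), IsAffineOpen V → ∀ g : G, g ≠ 1 →
      Ideal.span (Set.range fun s : Γ(S, p ⁻¹ᵁ V) ↦ ρ.act g V s - s) = ⊤)
    (X : AbelianSchemeOver S) (_hfin : ∀ F : Finset X.X.left, ∃ U : X.X.left.Opens, IsAffineOpen U ∧ ∀ x ∈ F, x ∈ U)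
    (ρX : ActionOver (X.X.hom ≫ p) G) (_hρX : ∀ g : G, (ρX.aut g).hom ≫ X.X.hom = X.X.hom ≫ (ρ.aut g).hom)
    (_hX : ∀ g : G, X.IsBaseChangeVia X (ρ.aut g).hom (ρX.aut g).hom),
    ∃ (Bh : AbelianSchemeOver Q) (πh : X.X.left ⟶ Bh.X.left),
      (∀ g : G, (ρX.aut g).hom ≫ πh = πh) ∧ X.IsBaseChangeVia Bh p πh ∧ Bh.X.left.IsSeparated := by
  intro S Q _ p G _ _ ρ hq _ _ _ _ hfree X hfin ρX _ hX
  haveI : IsSeparated p := IsSeparated.of_isAffineHom p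
  obtain ⟨B, π, ρA, hρA, -, -, -, hsep, hbc⟩ :=
    AbelianSchemeOver.exists_abelianScheme_desc_of_forall_finset X ρX.aut hX hfin hq hfree
  refine ⟨B, π, fun g => ?_, hbc, hsep⟩
  rw [← hρA g]
  exact ρA.aut_comp g

/-! ### (Md3) — the four `DualPair` fields descend along the free base quotient (B-p13 (g21)'s (E3), VERBATIM letter) -/

/-- **letter (Md3) `stub_F3Md3`** = B-p13 (g21)'s (E3) ★ p793105 `exists_dualPair_fields_of_free_base_quotient′`
(`Literature/AlgebraicGeometry/AbelianSchemes/DualPairBaseQuotientDescentOfNoetherian.lean`; = ★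
`DualPairBaseQuotientDescent.exists_dualPair_fields_of_free_base_quotient` with `[IsReduced D.hat.X.left]
[IsLocallyNoetherian D.hat.X.left]` replaced by `[IsLocallyNoetherian S]`), statement copied token for token and closed by `∀`:
the dual pair `D` of `A/S` descends along the free finite base quotient `p : S → Q` to the four property fields of a dual pair of
`B/Q` on `(B̂, 𝒫_B)` together with the Poincaré clause `(π × π̂)^*𝒫_B ≅ 𝒫`.  Discharged BY NAME over (E3).
[cite: MumfordFogartyKirwan1994, Ch. 7 §3, remark after Thm. 7.9 and Lemma 7.11 (pp. 139–140)]
[cite: MumfordFogartyKirwan1994, Ch. 6 §1 Cor. 6.8 (p. 118) and §2 (p. 121)] [cite: MumfordAV1970, §13 (p. 125)]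
[cite: MilneAV2008, I §8 pp. 36–37] [cite: SGA1, Exp. VIII Cor. 7.8] -/
theorem stub_F3Md3 : ∀ {S Q : Scheme.{0}} {p : S ⟶ Q} {G : Type} [Group G] [Fintype G] {ρ : ActionOver p G}
    (_hq : ρ.IsGeometricQuotient p) [IsAffineHom p]
    (_hfree : ∀ (V : Q.Opens), IsAffineOpen V → ∀ g : G, g ≠ 1 →
      Ideal.span (Set.range fun s : Γ(S, p ⁻¹ᵁ V) ↦ ρ.act g V s - s) = ⊤)
    (A : AbelianSchemeOver S) (D : A.DualPair)
    (B : AbelianSchemeOver Q) {π : A.X.left ⟶ B.X.left} (ρA : ActionOver π G) (hAB : A.IsBaseChangeVia B p π)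
    (hA : ∀ g : G, A.IsBaseChangeVia A (ρ.aut g).hom (ρA.aut g).hom)
    (Bh : AbelianSchemeOver Q) {πh : D.hat.X.left ⟶ Bh.X.left} (ρh : ActionOver πh G)
    (hABh : D.hat.IsBaseChangeVia Bh p πh)
    (hAh : ∀ g : G, D.hat.IsBaseChangeVia D.hat (ρ.aut g).hom (ρh.aut g).hom)
    [IsLocallyNoetherian S] [IsLocallyNoetherian Q] [LocallyOfFiniteType p] [Bh.X.left.IsSeparated]
    (_hP : ∀ g : G, Nonempty ((Scheme.Modules.pullback
      (pullback.map A.X.hom D.hat.X.hom A.X.hom D.hat.X.hom (ρA.aut g).hom (ρh.aut g).hom (ρ.aut g).hom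
        (hA g).fst.symm (hAh g).fst.symm)).obj D.P ≅ D.P)),
    ∃ PB : (B.prodLeft Bh).Modules, HasRank PB 1 ∧
      Nonempty ((Scheme.Modules.pullback (B.unitSlice Bh)).obj PB ≅ SheafOfModules.unit _) ∧
      (∀ (Ω : Type) [Field Ω] [IsAlgClosed Ω] (b : Spec (.of Ω) ⟶ Bh.X.left),
        IsHomogeneous (B.fibre (b ≫ Bh.X.hom)).toAbelianVariety
          ((Scheme.Modules.pullback (B.fibreSlice Bh b)).obj PB)) ∧
      (∀ {T : Scheme.{0}} (f : T ⟶ Q) (ℒ : B.RigidifiedLineBundle f), ℒ.FibrewisePicZero →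
        ∃! g : {g : T ⟶ Bh.X.left // g ≫ Bh.X.hom = f},
          Nonempty ((Scheme.Modules.pullback (B.baseChangeToProd Bh f g.1 g.2)).obj PB ≅ ℒ.L)) ∧
      Nonempty ((Scheme.Modules.pullback
        (pullback.map A.X.hom D.hat.X.hom B.X.hom Bh.X.hom π πh p hAB.fst.symm hABh.fst.symm)).obj PB ≅ D.P) := by
  intro S Q p G _ _ ρ hq _ hfree A D B π ρA hAB hA Bh πh ρh hABh hAh _ _ _ _ hP
  exact AbelianSchemeOver.exists_dualPair_fields_of_free_base_quotient' hq hfree A D B ρA hAB hA Bh ρh hABh hAh hP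

/-! ## §2 THE COMPOSITION — child ed. 5 §8 `stub_F3M_of` VERBATIM but for the three by-name calls (Ma)(Mb)(Mc) -/

/-- **`stub_F3M` FROM THE SECOND-LAYER LETTERS** (statement = tree `stub_F3M` :143 verbatim): split `K(L)` over the free finite
base quotient `p : S′ → Spec R` (Ma); build `(Â′, 𝒫′)` with the three property fields, the kernel clause and the socket (Mb); add
universality (Mc) — so `D′ := ⟨Â′, 𝒫′, …⟩` is a dual pair of `A ×_R S′`, hat-normalised by ★ `DualPair.normalize`; let `G` act on
the dual by uniqueness (Md1); descend the OBJECT `Â′/G =: B̂` (Md2) and the four fields (Md3); assemble `⟨B̂, 𝒫_B, …⟩ : A.DualPair`.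
[cite: MumfordAV1970, §13 Theorem (p. 125)] [cite: MumfordFogartyKirwan1994, Ch. 6 §1 Corollary 6.8 (p. 118) and §2 (p. 121)] -/
theorem stub_F3M_of (R : Type) [CommRing R] [IsNoetherianRing R] [Algebra ℚ R] [ConnectedSpace ↥(Spec (.of R))]
    (A : AbelianSchemeOver (Spec (.of R))) (hA : IsProjective A.X.hom) (L : A.left.Modules) (hL : HasRank L 1)
    (hε : CechPic.pullback A.unitSection (detClass (HasRank.isFiniteLocallyFree' hL)) = 1)
    (hΘ : ∀ ⦃Ω : Type⦄ [Field Ω] [IsAlgClosed Ω] (s : Spec (.of Ω) ⟶ Spec (.of R)),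
      ∃ Θ : CartierDivisor (A.fibre s).toAbelianVariety.X.left, Θ.IsAmple ∧
        CechPic.pullback (X := (A.fibre s).toAbelianVariety.X.left) (pullback.fst A.X.hom s)
          (detClass (HasRank.isFiniteLocallyFree' hL)) = Θ.cechClass)
    (hK : ∃ (Z : Over (Spec (.of R))) (i : Z ⟶ A.X) (_ : IsClosedImmersion i.left) (_ : IsFinite Z.hom) (_ : Etale Z.hom),
      ∀ (T : Over (Spec (.of R))) (u : T ⟶ A.X), (∃ v : T ⟶ Z, v ≫ i = u) ↔ A.MemKOfL L u) :
    Nonempty A.DualPair := by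
  classical
  obtain ⟨S', p, hS'aff, hS'noe, hpaff, hpfin, hplft, hpet, hpsurj, G, hGgrp, hGfin, ρ, ρA, hAB, hA₁, hq, hfree,
    K', hK'fin, hKinj, hK'⟩ := Summit.HodgeConjecture.CorCM.HypDel.F3DualAbelianSchemeM.stub_F3Ma_holds R A L hL hε hΘ hK
  have hA' : IsProjective (A.baseChange p).X.hom := by
    rw [AbelianSchemeOver.baseChange_hom]; exact hA.pullback_snd p
  obtain ⟨hat, π, hπmon, hπfin, hπet, hπsurj, P, hker, h1, hrig, hpic, hsock, hfinaff⟩ :=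
    F3DualAbelianSchemeM.stub_F3Mb_holds R A L hL hε hΘ p hA' K' hKinj hK'
  let D' : (A.baseChange p).DualPair :=
    ⟨hat, P, h1, hrig, hpic, fun f ℒ hℒ =>
      F3DualAbelianSchemeM.stub_F3Mc_holds R A L hL hε hΘ p hat π ⟨hπfin, hπet, hπsurj⟩ P hker h1 hrig hsock f ℒ hℒ⟩
  let D : (A.baseChange p).DualPair := D'.normalize
  have hunit : Nonempty ((Scheme.Modules.pullback (AbelianSchemeOver.DualPair.unitHatSlice D)).obj D.P ≅
      SheafOfModules.unit _) :=
    D'.nonempty_unitHatSlice_iso_normalize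
  obtain ⟨ρh, hρh, hAh, hP⟩ := stub_F3Md1 ρ hq hfree (A.baseChange p) D A ρA hAB hA₁ hunit
  have hfinaff' : ∀ F : Finset D.hat.X.left, ∃ U : D.hat.X.left.Opens, IsAffineOpen U ∧ ∀ x ∈ F, x ∈ U := hfinaff
  obtain ⟨Bh, πh, hinv, hABh, hsep⟩ := stub_F3Md2 ρ hq hfree D.hat hfinaff' ρh hρh hAh
  haveI := hsep
  let ρh' : ActionOver πh G := ⟨ρh.aut, hinv⟩
  obtain ⟨PB, hB1, hBrig, hBpic, hBuniv, -⟩ :=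
    stub_F3Md3 hq hfree (A.baseChange p) D A ρA hAB hA₁ Bh ρh' hABh hAh hP
  exact ⟨⟨Bh, PB, hB1, hBrig, hBpic, fun f ℒ hℒ => hBuniv f ℒ hℒ⟩⟩

end MClosure

/-! ## §3 THE HEAD — the parent letter `stub_F3M` token for token -/

/-- **stub (M) `stub_F3M` PROVED** — [MumfordAV1970] §13 Theorem (p. 125) run RELATIVE to a connected Noetherian affine `ℚ`-base
`Spec R`: a PROJECTIVE abelian scheme `A → Spec R` carrying a rank-one `L` rigidified along the identity section, fibrewise of
the class of an ample divisor, with `K(L)` represented by a finite étale closed subgroup scheme, HAS A DUAL PAIR (the six fields of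
★ `AbelianSchemeOver.DualPair`: `Â`, the Poincaré bundle `𝒫` of rank one rigidified along `ε × 1`, fibrewise in `Pic⁰`, universal).
Statement = `stub_F3M` of the registered F-3 sub-line (ed. 1.4), token for token; proof = the re-homed composition `MClosure.stub_F3M_of`
((Ma) split `K(L)` over a free finite base quotient → (Mb) Mumford's quotient and descended bundle over `S′` → (Mc) universality →
hat-normalise → (Md1) the `G`-action on the dual → (Md2) descend the object → (Md3) descend the four fields).
[cite: MumfordAV1970, §13 Theorem (p. 125) and §12 Thm. 1 (p. 112)] [cite: MumfordFogartyKirwan1994, Ch. 6 §1 Corollary 6.8 (p. 118) and §2 (p. 121)]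
[cite: MilneAV2008, I §8 pp. 36–37] -/
theorem stub_F3M_holds : ∀ (R : Type) [CommRing R] [IsNoetherianRing R] [Algebra ℚ R] [ConnectedSpace ↥(Spec (.of R))]
    (A : AbelianSchemeOver (Spec (.of R))) (_hA : IsProjective A.X.hom) (L : A.left.Modules) (hL : HasRank L 1)
    (_hε : CechPic.pullback A.unitSection (detClass (HasRank.isFiniteLocallyFree' hL)) = 1)
    (_hΘ : ∀ ⦃Ω : Type⦄ [Field Ω] [IsAlgClosed Ω] (s : Spec (.of Ω) ⟶ Spec (.of R)),
      ∃ Θ : CartierDivisor (A.fibre s).toAbelianVariety.X.left, Θ.IsAmple ∧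
        CechPic.pullback (X := (A.fibre s).toAbelianVariety.X.left) (pullback.fst A.X.hom s)
          (detClass (HasRank.isFiniteLocallyFree' hL)) = Θ.cechClass)
    (_hK : ∃ (Z : Over (Spec (.of R))) (i : Z ⟶ A.X) (_ : IsClosedImmersion i.left) (_ : IsFinite Z.hom) (_ : Etale Z.hom),
      ∀ (T : Over (Spec (.of R))) (u : T ⟶ A.X), (∃ v : T ⟶ Z, v ≫ i = u) ↔ A.MemKOfL L u),
    Nonempty A.DualPair :=
  fun R _ _ _ _ A hA L hL hε hΘ hK => MClosure.stub_F3M_of R A hA L hL hε hΘ hK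

end Summit.HodgeConjecture.CorCM.Cruxes.HypDel.F3DualAbelianScheme

end
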